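import Literature.Analysis.Fourier.HilbertTransformLineL2
import HarnessLib

/-!
# Uniqueness of classical decaying solutions of the viscous CLM on `ℝ` (L²-energy + M. Riesz)

HONEST FRAMING (cell ns-blowup GROUP B «PROFILE SEARCH», zone Z3, rows Z3-U / Z3-E12⁻ of `HOME/profile/z3/CENSUS-Z3.md`; human
rulings D-0035/D-0074): **1-D MODEL (the viscous Constantin–Lax–Majda equation `ω_t = ω·Hω + ν ω_xx` on `ℝ`, `H = hilbertTransform`
of `Literature/Analysis/Fourier/HilbertTransformLine.lean`); not Euler, not Navier–Stokes; «violates: none — MODEL».**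

THE THEOREM (`viscousCLM_line_unique`). A CLASSICAL DECAYING SOLUTION on `[0, T)` is a triple `ω, ωₓ, ωₓₓ : ℝ → ℝ → ℝ` (time first)
with, for `0 ≤ t < T` and all `x`: `∂ₓ ω(t,·) = ωₓ(t,·)`, `∂ₓ ωₓ(t,·) = ωₓₓ(t,·)`, envelope `|ω|, |ωₓ|, |ωₓₓ| ≤ C/(1+x²)` and
`|H[ω(t,·)]| ≤ C`; the PDE `∂ₜ ω = ω·H[ω(t,·)] + ν ωₓₓ` pointwise for `0 < t < T`; right-continuity of `t ↦ ω(t,x)` at `t = 0`.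
**Two such solutions with the same datum coincide on `[0, T) × ℝ`** (`ν ≥ 0`). PROOF: for `w = ω₁ − ω₂`, `E(t) = ∫ w²` is
differentiable on `(0,T)` (`hasDerivAt_integral_of_dominated_loc_of_deriv_le`) with `E′ = 2∫ w²·Hω₁ + 2∫ ω₂·w·Hw − 2ν∫ wₓ²`
(additivity of `H` on `C¹ ∩ L¹`, integration by parts on `ℝ`), and `2∫ ω₂ w Hw ≤ C∫(w² + (Hw)²) = 2C·E` by the M. RIESZ ISOMETRY
`∫(Hw)² = ∫w²` (`integral_hilbertTransform_sq_eq`); so `E′ ≤ 4C·E`, `E(0) = 0`, `E` right-continuous at `0` (dominated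
convergence) ⇒ `E ≡ 0` (Gronwall via `antitoneOn_of_deriv_nonpos` on `e^{−4Ct}E`) ⇒ `w ≡ 0`. Intended use: the Schochet–ALSS two-pole
solution (`SheetNSLineSchochetTwoPole*`) lies in this class on every `[0, T₁]`, `T₁ < T_blowup`, so its blow-up is the fate of EVERY
classical decaying solution from that small datum. WHAT IS NOT HERE: existence; weak solutions; anything about Navier–Stokes.
No definitions, no named facts. bears_on: LADDER-NS N5 / zone Z3 → N1 linear core.
-/

noncomputable section

namespace Summit.NavierStokesRegularity.OSWSelfSimilar
namespace SheetNSLineViscousCLMUnique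

open _root_.MeasureTheory Set Filter Literature.Analysis.Fourier
open scoped Real Topology

/-! ### Slice facts for a function with envelope `C/(1+x²)` -/

/-- `K/(1+x²)` is integrable. [folklore] -/
private theorem integrable_env (K : ℝ) : Integrable fun x : ℝ => K / (1 + x ^ 2) :=
  (integrable_inv_one_add_sq.const_mul K).congr (Eventually.of_forall fun x => by simp only [div_eq_mul_inv])

/-- A continuous function with `|f| ≤ K/(1+x²)` is integrable. [folklore] -/
theorem integrable_of_le_env {f : ℝ → ℝ} {K : ℝ} (hf : Continuous f) (hb : ∀ x, |f x| ≤ K / (1 + x ^ 2)) :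
    Integrable f :=
  Integrable.mono' (integrable_env K) hf.aestronglyMeasurable
    (Eventually.of_forall fun x => by rw [Real.norm_eq_abs]; exact hb x)

/-- An a.e.-strongly-measurable function with `|f| ≤ K/(1+x²)` is integrable. [folklore] -/
theorem integrable_of_le_env' {f : ℝ → ℝ} {K : ℝ} (hf : AEStronglyMeasurable f) (hb : ∀ x, |f x| ≤ K / (1 + x ^ 2)) :
    Integrable f :=
  Integrable.mono' (integrable_env K) hf (Eventually.of_forall fun x => by rw [Real.norm_eq_abs]; exact hb x)

/-- Product envelope: `|f| ≤ K/(1+x²)`, `|g| ≤ K'/(1+x²)` give `|f g| ≤ K K'/(1+x²)` (`K' ≥ 0`). [folklore] -/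
theorem abs_mul_le_env {f g : ℝ → ℝ} {K K' : ℝ} (hK' : 0 ≤ K') (hf : ∀ x, |f x| ≤ K / (1 + x ^ 2))
    (hg : ∀ x, |g x| ≤ K' / (1 + x ^ 2)) (x : ℝ) : |f x * g x| ≤ K * K' / (1 + x ^ 2) := by
  have h1 : (0:ℝ) < 1 + x ^ 2 := by positivity
  have hK : 0 ≤ K := by
    have := (abs_nonneg _).trans (hf 0)
    simpa using this
  have hg' : |g x| ≤ K' := (hg x).trans (div_le_self hK' (by nlinarith))
  rw [abs_mul]
  calc |f x| * |g x| ≤ K / (1 + x ^ 2) * K' := mul_le_mul (hf x) hg' (abs_nonneg _) (by positivity)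
    _ = K * K' / (1 + x ^ 2) := by ring

/-- A continuous function with envelope `K/(1+x²)` is in `L²`. [folklore] -/
theorem memLp_two_of_le_env {f : ℝ → ℝ} {K : ℝ} (hf : Continuous f) (hb : ∀ x, |f x| ≤ K / (1 + x ^ 2)) :
    MemLp f 2 := by
  rw [memLp_two_iff_integrable_sq hf.aestronglyMeasurable]
  have hK : 0 ≤ K := by
    have := (abs_nonneg _).trans (hb 0)
    simpa using this
  refine integrable_of_le_env (hf.pow 2) (K := K * K) fun x => ?_
  rw [show f x ^ 2 = f x * f x by ring]
  exact abs_mul_le_env hK hb hb x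

/-- `C¹` from everywhere-`HasDerivAt` with a differentiable derivative. [folklore] -/
theorem contDiff_one_of_hasDerivAt {f f' f'' : ℝ → ℝ} (h1 : ∀ x, HasDerivAt f (f' x) x)
    (h2 : ∀ x, HasDerivAt f' (f'' x) x) : ContDiff ℝ 1 f := by
  rw [contDiff_one_iff_deriv]
  have e : deriv f = f' := funext fun x => (h1 x).deriv
  refine ⟨fun x => (h1 x).differentiableAt, ?_⟩
  rw [e]
  exact continuous_iff_continuousAt.2 fun x => (h2 x).continuousAt

/-- Symmetric p.v. integrability at every point for a `C¹` slice with envelope. [folklore] -/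
theorem symm_integrable_of_env {f f' f'' : ℝ → ℝ} {K : ℝ} (h1 : ∀ x, HasDerivAt f (f' x) x)
    (h2 : ∀ x, HasDerivAt f' (f'' x) x) (hb : ∀ x, |f x| ≤ K / (1 + x ^ 2)) (x : ℝ) :
    IntegrableOn (fun t => (f (x - t) - f (x + t)) / t) (Ioi 0) :=
  integrableOn_symmIntegrand_of_contDiff (contDiff_one_of_hasDerivAt h1 h2)
    (integrable_of_le_env (continuous_iff_continuousAt.2 fun x => (h1 x).continuousAt) hb) x

/-- **M. Riesz for a slice:** `∫ (Hf)² = ∫ f²` and `Hf ∈ L²`. [cite: Grafakos2014, eq. (5.1.14)] -/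
theorem riesz_of_env {f f' f'' : ℝ → ℝ} {K : ℝ} (h1 : ∀ x, HasDerivAt f (f' x) x)
    (h2 : ∀ x, HasDerivAt f' (f'' x) x) (hb : ∀ x, |f x| ≤ K / (1 + x ^ 2)) :
    MemLp (hilbertTransform f) 2 ∧ ∫ x, (hilbertTransform f x) ^ 2 = ∫ x, (f x) ^ 2 := by
  have hc : Continuous f := continuous_iff_continuousAt.2 fun x => (h1 x).continuousAt
  have hi := integrable_of_le_env hc hb
  have h2' := memLp_two_of_le_env hc hb
  have hs := ae_of_all volume (symm_integrable_of_env h1 h2 hb)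
  exact ⟨memLp_two_hilbertTransform hi h2' hs, integral_hilbertTransform_sq_eq hi h2' hs⟩

/-- `H(f − g) = Hf − Hg` pointwise for two slices with envelopes. [folklore] -/
theorem hilbertTransform_sub_of_env {f f' f'' g g' g'' : ℝ → ℝ} {K K' : ℝ} (hf1 : ∀ x, HasDerivAt f (f' x) x)
    (hf2 : ∀ x, HasDerivAt f' (f'' x) x) (hfb : ∀ x, |f x| ≤ K / (1 + x ^ 2)) (hg1 : ∀ x, HasDerivAt g (g' x) x)
    (hg2 : ∀ x, HasDerivAt g' (g'' x) x) (hgb : ∀ x, |g x| ≤ K' / (1 + x ^ 2)) (x : ℝ) :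
    hilbertTransform (fun y => f y - g y) x = hilbertTransform f x - hilbertTransform g x := by
  have hsf := symm_integrable_of_env hf1 hf2 hfb x
  have hsg := symm_integrable_of_env hg1 hg2 hgb x
  have hsg' : IntegrableOn (fun t => ((fun y => -g y) (x - t) - (fun y => -g y) (x + t)) / t) (Ioi 0) := by
    refine IntegrableOn.congr_fun hsg.neg (fun t _ => ?_) measurableSet_Ioi
    simp only [Pi.neg_apply]
    ring
  have h := hilbertTransform_add (f := f) (g := fun y => -g y) hsf hsg'
  simp only [← sub_eq_add_neg] at h
  rw [h, hilbertTransform_neg, sub_eq_add_neg]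

/-! ### Measurability of a second derivative slice -/

/-- A second-derivative slice is measurable (it is `deriv` of a differentiable function). [folklore] -/
theorem aestronglyMeasurable_of_hasDerivAt {g g' : ℝ → ℝ} (h : ∀ x, HasDerivAt g (g' x) x) :
    AEStronglyMeasurable g' (volume : Measure ℝ) := by
  have e : g' = deriv g := funext fun x => (h x).deriv.symm
  rw [e]
  exact (measurable_deriv g).aestronglyMeasurable

/-! ### The energy argument -/

section Energy

variable {ν T C : ℝ} {ω₁ ωx₁ ωxx₁ ω₂ ωx₂ ωxx₂ : ℝ → ℝ → ℝ}

/-- **Uniqueness of classical decaying solutions of the viscous CLM on `ℝ`.** Two triples `(ωᵢ, ∂ₓωᵢ, ∂ₓₓωᵢ)` on `[0,T)`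
with `C²` slices, envelope `|ωᵢ|, |∂ₓωᵢ|, |∂ₓₓωᵢ| ≤ C/(1+x²)` and `|Hωᵢ| ≤ C`, the PDE `∂ₜωᵢ = ωᵢ·Hωᵢ + ν ∂ₓₓωᵢ` (genuine
`hilbertTransform`) pointwise on `(0,T)`, right-continuity in `t` at `0`, and the same datum, coincide on `[0, T) × ℝ`
(L²-energy, M. Riesz isometry, integration by parts, Gronwall). [cite: Grafakos2014, eq. (5.1.14) (the isometry used);
the energy argument is folklore] -/
theorem viscousCLM_line_unique (hν : 0 ≤ ν) (hC : 0 ≤ C)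
    (hx₁ : ∀ t ∈ Ico 0 T, ∀ x, HasDerivAt (ω₁ t) (ωx₁ t x) x)
    (hxx₁ : ∀ t ∈ Ico 0 T, ∀ x, HasDerivAt (ωx₁ t) (ωxx₁ t x) x)
    (hb₁ : ∀ t ∈ Ico 0 T, ∀ x, |ω₁ t x| ≤ C / (1 + x ^ 2) ∧ |ωx₁ t x| ≤ C / (1 + x ^ 2) ∧
      |ωxx₁ t x| ≤ C / (1 + x ^ 2) ∧ |hilbertTransform (ω₁ t) x| ≤ C)
    (ht₁ : ∀ t ∈ Ioo 0 T, ∀ x,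
      HasDerivAt (fun τ => ω₁ τ x) (ω₁ t x * hilbertTransform (ω₁ t) x + ν * ωxx₁ t x) t)
    (hc₁ : ∀ x, ContinuousWithinAt (fun τ => ω₁ τ x) (Ici 0) 0)
    (hx₂ : ∀ t ∈ Ico 0 T, ∀ x, HasDerivAt (ω₂ t) (ωx₂ t x) x)
    (hxx₂ : ∀ t ∈ Ico 0 T, ∀ x, HasDerivAt (ωx₂ t) (ωxx₂ t x) x)
    (hb₂ : ∀ t ∈ Ico 0 T, ∀ x, |ω₂ t x| ≤ C / (1 + x ^ 2) ∧ |ωx₂ t x| ≤ C / (1 + x ^ 2) ∧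
      |ωxx₂ t x| ≤ C / (1 + x ^ 2) ∧ |hilbertTransform (ω₂ t) x| ≤ C)
    (ht₂ : ∀ t ∈ Ioo 0 T, ∀ x,
      HasDerivAt (fun τ => ω₂ τ x) (ω₂ t x * hilbertTransform (ω₂ t) x + ν * ωxx₂ t x) t)
    (hc₂ : ∀ x, ContinuousWithinAt (fun τ => ω₂ τ x) (Ici 0) 0)
    (h0 : ∀ x, ω₁ 0 x = ω₂ 0 x) :
    ∀ t ∈ Ico 0 T, ∀ x, ω₁ t x = ω₂ t x := by
  -- the difference `w`, its derivatives, its energy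
  set w : ℝ → ℝ → ℝ := fun t x => ω₁ t x - ω₂ t x with hw
  set wx : ℝ → ℝ → ℝ := fun t x => ωx₁ t x - ωx₂ t x with hwxdef
  set wxx : ℝ → ℝ → ℝ := fun t x => ωxx₁ t x - ωxx₂ t x with hwxxdef
  set wt : ℝ → ℝ → ℝ := fun t x => (ω₁ t x * hilbertTransform (ω₁ t) x + ν * ωxx₁ t x)
    - (ω₂ t x * hilbertTransform (ω₂ t) x + ν * ωxx₂ t x) with hwtdef
  set E : ℝ → ℝ := fun t => ∫ x, w t x * w t x with hE
  have hwx : ∀ t ∈ Ico 0 T, ∀ x, HasDerivAt (w t) (wx t x) x := fun t ht x => (hx₁ t ht x).sub (hx₂ t ht x)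
  have hwxx : ∀ t ∈ Ico 0 T, ∀ x, HasDerivAt (wx t) (wxx t x) x := fun t ht x => (hxx₁ t ht x).sub (hxx₂ t ht x)
  have hwt : ∀ t ∈ Ioo 0 T, ∀ x, HasDerivAt (fun τ => w τ x) (wt t x) t := fun t ht x => (ht₁ t ht x).sub (ht₂ t ht x)
  have env2 : ∀ {a b : ℝ} {x : ℝ}, |a| ≤ C / (1 + x ^ 2) → |b| ≤ C / (1 + x ^ 2) → |a - b| ≤ 2 * C / (1 + x ^ 2) := by
    intro a b x ha hb
    calc |a - b| ≤ |a| + |b| := abs_sub _ _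
      _ ≤ C / (1 + x ^ 2) + C / (1 + x ^ 2) := add_le_add ha hb
      _ = 2 * C / (1 + x ^ 2) := by ring
  have hwb : ∀ t ∈ Ico 0 T, ∀ x, |w t x| ≤ 2 * C / (1 + x ^ 2) :=
    fun t ht x => env2 (hb₁ t ht x).1 (hb₂ t ht x).1
  have hwxb : ∀ t ∈ Ico 0 T, ∀ x, |wx t x| ≤ 2 * C / (1 + x ^ 2) :=
    fun t ht x => env2 (hb₁ t ht x).2.1 (hb₂ t ht x).2.1
  have hwxxb : ∀ t ∈ Ico 0 T, ∀ x, |wxx t x| ≤ 2 * C / (1 + x ^ 2) :=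
    fun t ht x => env2 (hb₁ t ht x).2.2.1 (hb₂ t ht x).2.2.1
  have hwc : ∀ t ∈ Ico 0 T, Continuous (w t) :=
    fun t ht => continuous_iff_continuousAt.2 fun x => (hwx t ht x).continuousAt
  have hwxc : ∀ t ∈ Ico 0 T, Continuous (wx t) :=
    fun t ht => continuous_iff_continuousAt.2 fun x => (hwxx t ht x).continuousAt
  -- constant bounds
  have le_C : ∀ {a : ℝ} {x : ℝ}, |a| ≤ C / (1 + x ^ 2) → |a| ≤ C := by
    intro a x ha
    exact ha.trans (div_le_self hC (by nlinarith [sq_nonneg x]))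
  have hwtb : ∀ t ∈ Ico 0 T, ∀ x, |wt t x| ≤ 2 * (C * C + ν * C) := by
    intro t ht x
    obtain ⟨h1, -, h3, h4⟩ := hb₁ t ht x
    obtain ⟨k1, -, k3, k4⟩ := hb₂ t ht x
    have a1 : |ω₁ t x * hilbertTransform (ω₁ t) x| ≤ C * C := by
      rw [abs_mul]; exact mul_le_mul (le_C h1) h4 (abs_nonneg _) hC
    have a2 : |ω₂ t x * hilbertTransform (ω₂ t) x| ≤ C * C := by
      rw [abs_mul]; exact mul_le_mul (le_C k1) k4 (abs_nonneg _) hC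
    have a3 : |ν * ωxx₁ t x| ≤ ν * C := by
      rw [abs_mul, abs_of_nonneg hν]; exact mul_le_mul_of_nonneg_left (le_C h3) hν
    have a4 : |ν * ωxx₂ t x| ≤ ν * C := by
      rw [abs_mul, abs_of_nonneg hν]; exact mul_le_mul_of_nonneg_left (le_C k3) hν
    simp only [hwtdef]
    calc |ω₁ t x * hilbertTransform (ω₁ t) x + ν * ωxx₁ t x - (ω₂ t x * hilbertTransform (ω₂ t) x + ν * ωxx₂ t x)|
        ≤ |ω₁ t x * hilbertTransform (ω₁ t) x + ν * ωxx₁ t x| + |ω₂ t x * hilbertTransform (ω₂ t) x + ν * ωxx₂ t x| :=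
          abs_sub _ _
      _ ≤ (|ω₁ t x * hilbertTransform (ω₁ t) x| + |ν * ωxx₁ t x|)
          + (|ω₂ t x * hilbertTransform (ω₂ t) x| + |ν * ωxx₂ t x|) := add_le_add (abs_add_le _ _) (abs_add_le _ _)
      _ ≤ 2 * (C * C + ν * C) := by linarith
  -- `H` of the difference, Riesz for the difference
  have hHw : ∀ t ∈ Ico 0 T, ∀ x, hilbertTransform (w t) x = hilbertTransform (ω₁ t) x - hilbertTransform (ω₂ t) x :=
    fun t ht x => hilbertTransform_sub_of_env (hx₁ t ht) (hxx₁ t ht) (fun x => (hb₁ t ht x).1) (hx₂ t ht) (hxx₂ t ht)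
      (fun x => (hb₂ t ht x).1) x
  have hRw : ∀ t ∈ Ico 0 T, MemLp (hilbertTransform (w t)) 2 ∧
      ∫ x, (hilbertTransform (w t) x) ^ 2 = ∫ x, (w t x) ^ 2 :=
    fun t ht => riesz_of_env (hwx t ht) (hwxx t ht) (hwb t ht)
  have hHmeas : ∀ t ∈ Ico 0 T, AEStronglyMeasurable (hilbertTransform (ω₁ t)) ∧
      AEStronglyMeasurable (hilbertTransform (ω₂ t)) :=
    fun t ht => ⟨(riesz_of_env (hx₁ t ht) (hxx₁ t ht) (fun x => (hb₁ t ht x).1)).1.aestronglyMeasurable,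
      (riesz_of_env (hx₂ t ht) (hxx₂ t ht) (fun x => (hb₂ t ht x).1)).1.aestronglyMeasurable⟩
  have hwt_meas : ∀ t ∈ Ico 0 T, AEStronglyMeasurable (wt t) := by
    intro t ht
    obtain ⟨m1, m2⟩ := hHmeas t ht
    have c1 : Continuous (ω₁ t) := continuous_iff_continuousAt.2 fun x => (hx₁ t ht x).continuousAt
    have c2 : Continuous (ω₂ t) := continuous_iff_continuousAt.2 fun x => (hx₂ t ht x).continuousAt
    have d1 := aestronglyMeasurable_of_hasDerivAt (hxx₁ t ht)
    have d2 := aestronglyMeasurable_of_hasDerivAt (hxx₂ t ht)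
    exact ((c1.aestronglyMeasurable.mul m1).add (aestronglyMeasurable_const.mul d1)).sub
      ((c2.aestronglyMeasurable.mul m2).add (aestronglyMeasurable_const.mul d2))
  -- energy: integrable slices
  have hE_int : ∀ t ∈ Ico 0 T, Integrable (fun x => w t x * w t x) :=
    fun t ht => integrable_of_le_env ((hwc t ht).mul (hwc t ht)) (abs_mul_le_env (by positivity) (hwb t ht) (hwb t ht))
  -- STEP 1: `E` is differentiable on `(0,T)` with `E' = ∫ (wt·w + w·wt)`
  have hEd : ∀ t ∈ Ioo 0 T, Integrable (fun x => wt t x * w t x + w t x * wt t x) ∧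
      HasDerivAt E (∫ x, wt t x * w t x + w t x * wt t x) t := by
    intro t ht
    have htI : t ∈ Ico 0 T := ⟨ht.1.le, ht.2⟩
    have hs : Ioo 0 T ∈ 𝓝 t := Ioo_mem_nhds ht.1 ht.2
    refine hasDerivAt_integral_of_dominated_loc_of_deriv_le (μ := volume) (F := fun τ x => w τ x * w τ x)
      (F' := fun τ x => wt τ x * w τ x + w τ x * wt τ x) (bound := fun x => 8 * C * (C * C + ν * C) / (1 + x ^ 2))
      hs ?_ (hE_int t htI) ?_ ?_ (integrable_env _) ?_
    · filter_upwards [hs] with τ hτ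
      exact ((hwc τ ⟨hτ.1.le, hτ.2⟩).mul (hwc τ ⟨hτ.1.le, hτ.2⟩)).aestronglyMeasurable
    · exact ((hwt_meas t htI).mul (hwc t htI).aestronglyMeasurable).add
        ((hwc t htI).aestronglyMeasurable.mul (hwt_meas t htI))
    · refine ae_of_all _ fun x τ hτ => ?_
      have hτI : τ ∈ Ico 0 T := ⟨hτ.1.le, hτ.2⟩
      have e : wt τ x * w τ x + w τ x * wt τ x = 2 * (w τ x * wt τ x) := by ring
      rw [Real.norm_eq_abs, e, abs_mul, abs_mul, abs_two]
      have h1 := hwb τ hτI x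
      have h2 := hwtb τ hτI x
      have hpos : (0:ℝ) < 1 + x ^ 2 := by positivity
      calc 2 * (|w τ x| * |wt τ x|) ≤ 2 * (2 * C / (1 + x ^ 2) * (2 * (C * C + ν * C))) :=
            mul_le_mul_of_nonneg_left (mul_le_mul h1 h2 (abs_nonneg _) (by positivity)) (by norm_num)
        _ = 8 * C * (C * C + ν * C) / (1 + x ^ 2) := by
            simp only [div_mul_eq_mul_div, mul_div_assoc']
            congr 1
            ring
    · exact ae_of_all _ fun x τ hτ => (hwt τ hτ x).mul (hwt τ hτ x)
  -- STEP 2: `E' ≤ 4C·E` on `(0,T)`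
  have hE' : ∀ t ∈ Ioo 0 T, (∫ x, wt t x * w t x + w t x * wt t x) ≤ 4 * C * E t := by
    intro t ht
    have htI : t ∈ Ico 0 T := ⟨ht.1.le, ht.2⟩
    obtain ⟨hF'int, -⟩ := hEd t ht
    obtain ⟨hHwL2, hRiesz⟩ := hRw t htI
    have hRiesz' : ∫ x, hilbertTransform (w t) x * hilbertTransform (w t) x = E t := by
      simp only [hE]
      have e1 : (fun x => hilbertTransform (w t) x * hilbertTransform (w t) x) = fun x => (hilbertTransform (w t) x) ^ 2 :=
        funext fun x => by ring
      have e2 : (fun x => w t x * w t x) = fun x => (w t x) ^ 2 := funext fun x => by ring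
      rw [e1, e2, hRiesz]
    -- integrability of the pieces
    have iw2 : Integrable (fun x => w t x * w t x) := hE_int t htI
    have iH2 : Integrable (fun x => hilbertTransform (w t) x * hilbertTransform (w t) x) := by
      have := hHwL2.integrable_sq
      refine this.congr (Eventually.of_forall fun x => ?_)
      simp only
      ring
    have iwwxx : Integrable (fun x => w t x * wxx t x) :=
      integrable_of_le_env' ((hwc t htI).aestronglyMeasurable.mul (aestronglyMeasurable_of_hasDerivAt (hwxx t htI)))
        (abs_mul_le_env (by positivity) (hwb t htI) (hwxxb t htI))
    have iwxwx : Integrable (fun x => wx t x * wx t x) :=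
      integrable_of_le_env ((hwxc t htI).mul (hwxc t htI)) (abs_mul_le_env (by positivity) (hwxb t htI) (hwxb t htI))
    have iwwx : Integrable (fun x => w t x * wx t x) :=
      integrable_of_le_env ((hwc t htI).mul (hwxc t htI)) (abs_mul_le_env (by positivity) (hwb t htI) (hwxb t htI))
    -- integration by parts: `∫ w·wxx = −∫ wx²`
    have hparts : ∫ x, w t x * wxx t x = -∫ x, wx t x * wx t x :=
      integral_mul_deriv_eq_deriv_mul_of_integrable (u := w t) (v := wx t) (u' := wx t) (v' := wxx t)
        (fun x _ => hwx t htI x) (fun x _ => hwxx t htI x) iwwxx iwxwx iwwx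
    have hparts_le : ∫ x, w t x * wxx t x ≤ 0 := by
      rw [hparts, neg_nonpos]
      exact integral_nonneg fun x => mul_self_nonneg _
    -- pointwise bound of the integrand
    have hpt : ∀ x, wt t x * w t x + w t x * wt t x
        ≤ 2 * C * (w t x * w t x) + (C * (w t x * w t x) + C * (hilbertTransform (w t) x * hilbertTransform (w t) x))
          + 2 * ν * (w t x * wxx t x) := by
      intro x
      obtain ⟨-, -, -, h4⟩ := hb₁ t htI x
      obtain ⟨k1, -, -, -⟩ := hb₂ t htI x
      have ek : wt t x = w t x * hilbertTransform (ω₁ t) x + ω₂ t x * hilbertTransform (w t) x + ν * wxx t x := by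
        rw [hHw t htI x]
        simp only [hwtdef, hw, hwxxdef]
        ring
      have q1 : 2 * (w t x * w t x) * hilbertTransform (ω₁ t) x ≤ 2 * C * (w t x * w t x) := by
        have hww : 0 ≤ w t x * w t x := mul_self_nonneg _
        nlinarith [abs_le.1 h4]
      have q2 : 2 * ω₂ t x * w t x * hilbertTransform (w t) x
          ≤ C * (w t x * w t x) + C * (hilbertTransform (w t) x * hilbertTransform (w t) x) := by
        have hC2 : |ω₂ t x| ≤ C := le_C k1
        have s1 : 2 * ω₂ t x * w t x * hilbertTransform (w t) x ≤ 2 * |ω₂ t x| * |w t x * hilbertTransform (w t) x| := by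
          have := le_abs_self (ω₂ t x * (w t x * hilbertTransform (w t) x))
          rw [abs_mul] at this
          linarith
        have s2 : 2 * |w t x * hilbertTransform (w t) x| ≤ w t x * w t x + hilbertTransform (w t) x * hilbertTransform (w t) x := by
          rw [abs_mul]
          nlinarith [sq_nonneg (|w t x| - |hilbertTransform (w t) x|), sq_abs (w t x), sq_abs (hilbertTransform (w t) x)]
        nlinarith [abs_nonneg (ω₂ t x), abs_nonneg (w t x * hilbertTransform (w t) x)]
      rw [ek]
      nlinarith
    have i1 : Integrable (fun x => 2 * C * (w t x * w t x)) := iw2.const_mul _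
    have i2 : Integrable (fun x => C * (w t x * w t x)) := iw2.const_mul _
    have i3 : Integrable (fun x => C * (hilbertTransform (w t) x * hilbertTransform (w t) x)) := iH2.const_mul _
    have i4 : Integrable (fun x => 2 * ν * (w t x * wxx t x)) := iwwxx.const_mul _
    have i23 : Integrable (fun x => C * (w t x * w t x) + C * (hilbertTransform (w t) x * hilbertTransform (w t) x)) :=
      i2.add i3
    have i123 : Integrable (fun x => 2 * C * (w t x * w t x)
        + (C * (w t x * w t x) + C * (hilbertTransform (w t) x * hilbertTransform (w t) x))) := i1.add i23
    have hEt : E t = ∫ x, w t x * w t x := rfl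
    calc (∫ x, wt t x * w t x + w t x * wt t x)
        ≤ ∫ x, 2 * C * (w t x * w t x) + (C * (w t x * w t x) + C * (hilbertTransform (w t) x * hilbertTransform (w t) x))
          + 2 * ν * (w t x * wxx t x) := integral_mono hF'int (i123.add i4) hpt
      _ = 2 * C * E t + (C * E t + C * E t) + 2 * ν * ∫ x, w t x * wxx t x := by
          rw [integral_add i123 i4, integral_add i1 i23, integral_add i2 i3, integral_const_mul, integral_const_mul,
            integral_const_mul, integral_const_mul, hRiesz', hEt]
      _ ≤ 4 * C * E t := by nlinarith [mul_nonpos_of_nonneg_of_nonpos (by positivity : (0:ℝ) ≤ 2 * ν) hparts_le]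
  -- STEP 3: right-continuity of `E` at `0`, continuity on `(0,T)`, `E 0 = 0`, `E ≥ 0`
  have hE0 : E 0 = 0 := by
    simp only [hE, hw, h0, sub_self, mul_zero, integral_zero]
  have hEnn : ∀ t, 0 ≤ E t := fun t => integral_nonneg fun x => mul_self_nonneg _
  have hEc0 : ∀ t₁, t₁ < T → ContinuousWithinAt E (Icc 0 t₁) 0 := by
    intro t₁ ht₁
    simp only [ContinuousWithinAt, hE]
    refine tendsto_integral_filter_of_dominated_convergence (fun x => 2 * C * (2 * C) / (1 + x ^ 2)) ?_ ?_
      (integrable_env _) ?_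
    · filter_upwards [self_mem_nhdsWithin] with τ hτ
      have hτI : τ ∈ Ico 0 T := ⟨hτ.1, hτ.2.trans_lt ht₁⟩
      exact ((hwc τ hτI).mul (hwc τ hτI)).aestronglyMeasurable
    · filter_upwards [self_mem_nhdsWithin] with τ hτ
      have hτI : τ ∈ Ico 0 T := ⟨hτ.1, hτ.2.trans_lt ht₁⟩
      exact ae_of_all _ fun x => by
        rw [Real.norm_eq_abs]
        exact abs_mul_le_env (by positivity) (hwb τ hτI) (hwb τ hτI) x
    · refine ae_of_all _ fun x => ?_
      have h := ((hc₁ x).sub (hc₂ x)).mono (Icc_subset_Ici_self : Icc (0:ℝ) t₁ ⊆ Ici 0)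
      exact h.mul h
  -- STEP 4: Gronwall — `E ≡ 0` on `[0,T)`
  have hEzero : ∀ t₁ ∈ Ico 0 T, E t₁ = 0 := by
    intro t₁ ht₁
    rcases eq_or_lt_of_le ht₁.1 with h | h
    · rw [← h]; exact hE0
    set G : ℝ → ℝ := fun τ => Real.exp (-(4 * C) * τ) * E τ with hG
    have hGd : ∀ τ ∈ Ioo 0 t₁, HasDerivAt G (Real.exp (-(4 * C) * τ) *
        ((∫ x, wt τ x * w τ x + w τ x * wt τ x) - 4 * C * E τ)) τ := by
      intro τ hτ
      have hτ' : τ ∈ Ioo 0 T := ⟨hτ.1, hτ.2.trans ht₁.2⟩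
      have he : HasDerivAt (fun τ => Real.exp (-(4 * C) * τ)) (Real.exp (-(4 * C) * τ) * (-(4 * C))) τ := by
        have := ((hasDerivAt_id τ).const_mul (-(4 * C))).exp
        simpa using this
      refine (he.mul (hEd τ hτ').2).congr_deriv ?_
      ring
    have hGcont : ContinuousOn G (Icc 0 t₁) := by
      intro τ hτ
      have hexp : ContinuousWithinAt (fun τ => Real.exp (-(4 * C) * τ)) (Icc 0 t₁) τ :=
        (Real.continuous_exp.comp (continuous_const.mul continuous_id)).continuousWithinAt
      rcases eq_or_lt_of_le hτ.1 with h0τ | h0τ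
      · subst h0τ
        exact hexp.mul (hEc0 t₁ ht₁.2)
      · have hτ' : τ ∈ Ioo 0 T := ⟨h0τ, hτ.2.trans_lt ht₁.2⟩
        exact hexp.mul (hEd τ hτ').2.continuousAt.continuousWithinAt
    have hGanti : AntitoneOn G (Icc 0 t₁) := by
      refine antitoneOn_of_deriv_nonpos (convex_Icc 0 t₁) hGcont ?_ ?_
      · rw [interior_Icc]
        exact fun τ hτ => (hGd τ hτ).differentiableAt.differentiableWithinAt
      · rw [interior_Icc]
        intro τ hτ
        rw [(hGd τ hτ).deriv]
        have hτ' : τ ∈ Ioo 0 T := ⟨hτ.1, hτ.2.trans ht₁.2⟩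
        have := hE' τ hτ'
        exact mul_nonpos_of_nonneg_of_nonpos (Real.exp_pos _).le (by linarith)
    have hle : G t₁ ≤ G 0 := hGanti (left_mem_Icc.2 h.le) (right_mem_Icc.2 h.le) h.le
    have hG0 : G 0 = 0 := by simp [hG, hE0]
    rw [hG0, show G t₁ = Real.exp (-(4 * C) * t₁) * E t₁ from rfl] at hle
    nlinarith [hEnn t₁, Real.exp_pos (-(4 * C) * t₁)]
  -- STEP 5: `E = 0` forces `w = 0` (continuity)
  intro t ht x
  have hint0 : ∫ x, w t x * w t x = 0 := hEzero t ht
  have hae : (fun x => w t x * w t x) =ᵐ[volume] 0 :=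
    (integral_eq_zero_iff_of_nonneg (fun x => mul_self_nonneg _) (hE_int t ht)).1 hint0
  have heq : (fun x => w t x * w t x) = 0 :=
    (Continuous.ae_eq_iff_eq volume ((hwc t ht).mul (hwc t ht)) continuous_const).1 hae
  have : w t x = 0 := mul_self_eq_zero.1 (congrFun heq x)
  simpa [hw, sub_eq_zero] using this

end Energy

end SheetNSLineViscousCLMUnique
end Summit.NavierStokesRegularity.OSWSelfSimilar

end
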